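import Summits.CriticalPhenomena.PercolationContinuityZ3.Theorems.PercTorusSliceFillingThinClusterTransportGlue
import Summits.CriticalPhenomena.PercolationContinuityZ3.Theorems.PercTorusSliceFillingThinClusterTransportLocal

/-!
# Route `PercTorusSliceFilling`, item `ThinClusterTransport` (stmt-CriticalPhenomena-5418) — closed

`ThinClusterTransport : ThinClusterRarity → TorusNonProliferation`. The substance is the transport
lemma `SliceFillingTransport` (Lemma E of the card, box form), proved here unconditionally
(`sliceFillingTransport_holds`): for all `p` and `n ≥ 4`, with `m = ⌊(n-2)/2⌋`,
`E_{T_n,p}[N_sf] ≤ n³ · E_{ℤ³,p}[1{0 ↔ ∂ⁱⁿB(m) in B(m)} / |C^{B(m)}(0)|]`; the item follows by the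
Markov glue of `PercTorusSliceFillingThinClusterTransportGlue`.

* **Chart.** For `2m + 2 ≤ n` and a base point `x ∈ T_n = (ℤ/nℤ)³`, the chart `f : B(m) → T_n`,
  `w ↦ proj w + x`, is injective, pulls the torus graph back to the `ℤ³` graph on the box
  (`comap_chart_eq`), maps inner-boundary points of the box onto the image points with a
  torus-neighbour outside the image, and its image misses a slice in every direction; hence the
  torus configuration pulled back along `f` and the box-restricted `ℤ³` configuration have the same
  law (`integral_restrictConfig_chart_eq`, via `bondPercolation_map_comap`). The chart is passed
  around as a function `f` with its defining equation `hf` (no new definitions).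
* **Transport.** `N_sf = Σ_x 1{C(x) sf}/|C(x)|` (`ncard_clusters_eq_sum`); a.s.
  `1{C(x) sf}/|C(x)| ≤ F(ω|_f)` with `F(η) = 1{0 ↔ ∂ⁱⁿB(m) in η}/|C_η(0)|` (a slice-filling cluster
  leaves the image of the chart through the image of `∂ⁱⁿB(m)`, and the local cluster injects into
  `C(x)`), `E F(ω|_f) = E F(ω|_{B(m)})` by the local law, and `F(ω|_{B(m)})` is the `ℤ³` integrand;
  summing over the `n³` base points gives the claim.
-/

namespace Summit.CriticalPhenomena.PercolationContinuityZ3.Theorems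

open MeasureTheory Set Filter
open scoped Classical
open Literature.Probability.Percolation Literature.Probability.LatticeModels
open Summit.CriticalPhenomena.PercolationContinuityZ3.Theses.PercTorusSliceFilling

namespace PercTorusSliceFillingThinClusterTransport

variable {n m : ℕ}

/-! ### The local chart of the torus -/

/-- An integer of absolute value `< n` which vanishes mod `n` is zero. [folklore] -/
theorem int_eq_zero_of_zmod_eq_zero {a : ℤ} (ha : |a| < n) (h : ((a : ℤ) : ZMod n) = 0) :
    a = 0 := by
  rw [ZMod.intCast_zmod_eq_zero_iff_dvd] at h
  exact Int.eq_zero_of_abs_lt_dvd h ha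

/-- The chart of a sum: `proj (y + z) + x = (proj y + x) + proj z`. [folklore] -/
theorem proj_add_add (n : ℕ) (y z : Site 3) (x : TorusSite 3 n) :
    Torus.proj n (y + z) + x = Torus.proj n y + x + Torus.proj n z := by
  funext j
  simp only [Pi.add_apply, Torus.proj_apply, Int.cast_add]
  ring

/-- The chart of a difference: `proj (y - z) + x = (proj y + x) - proj z`. [folklore] -/
theorem proj_sub_add (n : ℕ) (y z : Site 3) (x : TorusSite 3 n) :
    Torus.proj n (y - z) + x = Torus.proj n y + x - Torus.proj n z := by
  funext j
  simp only [Pi.add_apply, Pi.sub_apply, Torus.proj_apply, Int.cast_sub]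
  ring

/-- `u = u + proj 0` (the form in which `proj 0 = 0` is consumed by `eq_add_of_proj_eq` with
`v = 0`). [folklore] -/
theorem self_eq_add_proj_zero (n : ℕ) (u : TorusSite 3 n) :
    u = u + Torus.proj n (0 : Site 3) := by
  funext j
  simp [Torus.proj_apply]

/-- `Torus.proj` of a unit coordinate vector is the unit coordinate vector. [folklore] -/
theorem proj_single (n : ℕ) (i : Fin 3) :
    Torus.proj n (Pi.single i (1 : ℤ) : Site 3) = Pi.single i (1 : ZMod n) := by
  funext j
  by_cases h : j = i
  · subst h; simp [Torus.proj_apply]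
  · simp [Torus.proj_apply, Pi.single_eq_of_ne h]

/-- Coordinates of a unit coordinate vector have absolute value `≤ 1`. [folklore] -/
theorem abs_single_apply_le (i j : Fin 3) : |(Pi.single i (1 : ℤ) : Site 3) j| ≤ 1 := by
  by_cases h : j = i
  · subst h; simp
  · simp [Pi.single_eq_of_ne h]

/-- Two points of `B(m)` have coordinates differing by at most `2m`. [folklore] -/
theorem abs_sub_apply_le_of_mem_box {y z : Site 3} (hy : y ∈ box 3 m) (hz : z ∈ box 3 m)
    (j : Fin 3) : |y j - z j| ≤ 2 * m := by
  rw [mem_box] at hy hz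
  obtain ⟨h1, h2⟩ := hy j
  obtain ⟨h3, h4⟩ := hz j
  rw [abs_le]
  constructor <;> linarith

/-- **Rigidity of the chart**: for `y, z ∈ B(m)`, `|v|_∞ ≤ 1` and `2m + 2 ≤ n`, the congruence
`proj y + x = proj z + x + proj v` forces `y = z + v`. [folklore] -/
theorem eq_add_of_proj_eq (hmn : 2 * m + 2 ≤ n) {y z v : Site 3} (hy : y ∈ box 3 m)
    (hz : z ∈ box 3 m) (hv : ∀ j, |v j| ≤ 1) (x : TorusSite 3 n)
    (h : Torus.proj n y + x = Torus.proj n z + x + Torus.proj n v) : y = z + v := by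
  funext j
  have hj := congr_fun h j
  simp only [Pi.add_apply, Torus.proj_apply] at hj
  have h0 : (((y j - z j - v j : ℤ)) : ZMod n) = 0 := by
    push_cast
    linear_combination hj
  have habs : |y j - z j - v j| < n := by
    have h1 := abs_sub_apply_le_of_mem_box hy hz j
    have h2 := hv j
    have h3 : (2 * m + 1 : ℤ) < n := by omega
    calc |y j - z j - v j| ≤ |y j - z j| + |v j| := abs_sub _ _
      _ ≤ 2 * m + 1 := by linarith
      _ < n := h3
  have := int_eq_zero_of_zmod_eq_zero habs h0
  rw [Pi.add_apply]
  linarith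

/-- The chart is injective. [folklore] -/
theorem chart_injective (hmn : 2 * m + 2 ≤ n) (x : TorusSite 3 n)
    (f : ↥(box 3 m) → TorusSite 3 n) (hf : ∀ w, f w = Torus.proj n w.1 + x) :
    Function.Injective f := by
  intro w w' h
  rw [hf, hf] at h
  apply Subtype.ext
  have key := eq_add_of_proj_eq hmn w.2 w'.2 (v := 0) (fun j => by simp) x
    (by rw [h]; exact self_eq_add_proj_zero n _)
  simpa using key

/-- **The chart is a local isomorphism**: it pulls the torus graph back to the `ℤ³` graph on the
box. [folklore] -/
theorem comap_chart_eq (hmn : 2 * m + 2 ≤ n) (x : TorusSite 3 n)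
    (f : ↥(box 3 m) → TorusSite 3 n) (hf : ∀ w, f w = Torus.proj n w.1 + x) :
    (torusGraph 3 n).comap f = (zdGraph 3).comap (Subtype.val : ↥(box 3 m) → Site 3) := by
  ext w w'
  simp only [SimpleGraph.comap_adj, torusGraph_adj_iff, zdGraph_adj_iff, hf]
  constructor
  · rintro ⟨-, ⟨i, hi⟩ | ⟨i, hi⟩⟩
    · refine ⟨i, Or.inl ?_⟩
      exact eq_add_of_proj_eq hmn w'.2 w.2 (abs_single_apply_le i) x (by rw [hi, proj_single])
    · refine ⟨i, Or.inr ?_⟩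
      exact eq_add_of_proj_eq hmn w.2 w'.2 (abs_single_apply_le i) x (by rw [hi, proj_single])
  · rintro ⟨i, h | h⟩
    · refine ⟨?_, Or.inl ⟨i, ?_⟩⟩
      · intro heq
        have key := eq_add_of_proj_eq hmn w.2 w'.2 (v := 0) (fun j => by simp) x
          (by rw [heq]; exact self_eq_add_proj_zero n _)
        rw [add_zero] at key
        have h1 := congr_fun h i
        rw [key, Pi.add_apply, Pi.single_eq_same] at h1
        linarith
      · rw [h, proj_add_add, proj_single]
    · refine ⟨?_, Or.inr ⟨i, ?_⟩⟩
      · intro heq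
        have key := eq_add_of_proj_eq hmn w.2 w'.2 (v := 0) (fun j => by simp) x
          (by rw [heq]; exact self_eq_add_proj_zero n _)
        rw [add_zero] at key
        have h1 := congr_fun h i
        rw [key, Pi.add_apply, Pi.single_eq_same] at h1
        linarith
      · rw [h, proj_add_add, proj_single]

/-- **Boundary transfer**: if `f w` has a torus-neighbour outside the image of the chart then `w`
lies on the inner vertex boundary of the box. [folklore] -/
theorem mem_innerBoundary_of_adj_chart (x : TorusSite 3 n)
    (f : ↥(box 3 m) → TorusSite 3 n) (hf : ∀ w, f w = Torus.proj n w.1 + x) (w : ↥(box 3 m))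
    {y' : TorusSite 3 n} (hy' : y' ∉ Set.range f) (hadj : (torusGraph 3 n).Adj (f w) y') :
    w.1 ∈ innerBoundary (zdGraph 3) (box 3 m) := by
  rw [mem_innerBoundary_iff]
  refine ⟨w.2, ?_⟩
  rw [torusGraph_adj_iff, hf] at hadj
  obtain ⟨-, ⟨i, hi⟩ | ⟨i, hi⟩⟩ := hadj
  · refine ⟨w.1 + Pi.single i 1, fun hmem => hy' ⟨⟨_, hmem⟩, ?_⟩,
      (zdGraph_adj_iff _ _).2 ⟨i, Or.inl rfl⟩⟩
    rw [hf, hi, proj_add_add, proj_single]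
  · have hy : y' = Torus.proj n w.1 + x - Pi.single i 1 := eq_sub_iff_add_eq.2 hi.symm
    refine ⟨w.1 - Pi.single i 1, fun hmem => hy' ⟨⟨_, hmem⟩, ?_⟩,
      (zdGraph_adj_iff _ _).2 ⟨i, Or.inr (by simp)⟩⟩
    rw [hf, proj_sub_add, proj_single, hy]

/-- **The image of the chart misses a slice in every direction** (`2m + 1 < n`). [folklore] -/
theorem exists_slice_disjoint_chart (hmn : 2 * m + 2 ≤ n) (x : TorusSite 3 n)
    (f : ↥(box 3 m) → TorusSite 3 n) (hf : ∀ w, f w = Torus.proj n w.1 + x) (i : Fin 3) :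
    ∃ t : ZMod n, ∀ w, f w i ≠ t := by
  refine ⟨(((m : ℤ) + 1 : ℤ) : ZMod n) + x i, fun w h => ?_⟩
  rw [hf] at h
  simp only [Pi.add_apply, Torus.proj_apply, add_left_inj] at h
  have h0 : (((w.1 i - ((m : ℤ) + 1) : ℤ)) : ZMod n) = 0 := by
    push_cast at h ⊢
    rw [h]
    ring
  have hw := (mem_box.1 w.2) i
  have habs : |w.1 i - ((m : ℤ) + 1)| < n := by
    have h3 : (2 * m + 1 : ℤ) < n := by omega
    rw [abs_lt]
    constructor <;> linarith
  have := int_eq_zero_of_zmod_eq_zero habs h0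
  linarith

/-- The chart sends the centre of the box to the base point. [folklore] -/
theorem chart_zero (x : TorusSite 3 n)
    (f : ↥(box 3 m) → TorusSite 3 n) (hf : ∀ w, f w = Torus.proj n w.1 + x) :
    f ⟨0, zero_mem_box 3 m⟩ = x := by
  rw [hf]
  funext j
  simp [Torus.proj_apply]

/-- **Local law.** The restriction of `P_p^{T_n}` along the chart and the restriction of
`P_p^{ℤ³}` to the box `B(m)` have the same law: both are `P_p` of the box graph
(`bondPercolation_map_comap` twice and `comap_chart_eq`). Stated as equality of the integrals of an
arbitrary function of the local configuration. [folklore] -/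
theorem integral_restrictConfig_chart_eq (hmn : 2 * m + 2 ≤ n) (x : TorusSite 3 n)
    (f : ↥(box 3 m) → TorusSite 3 n) (hf : ∀ w, f w = Torus.proj n w.1 + x) (p : unitInterval)
    (g : BondConfig ↥(box 3 m) → ℝ) :
    ∫ ω, g (restrictConfig f ω) ∂(bondPercolation (torusGraph 3 n) p) =
      ∫ ω, g (restrictConfig (Subtype.val : ↥(box 3 m) → Site 3) ω)
        ∂(bondPercolation (zdGraph 3) p) := by
  have hmeas : ∀ μ : Measure (BondConfig ↥(box 3 m)), AEStronglyMeasurable g μ := fun μ =>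
    (Measurable.of_discrete (f := g)).aestronglyMeasurable
  rw [← integral_map (measurable_restrictConfig f).aemeasurable (hmeas _),
    ← integral_map (measurable_restrictConfig _).aemeasurable (hmeas _),
    bondPercolation_map_comap _ (chart_injective hmn x f hf),
    bondPercolation_map_comap _ Subtype.val_injective, comap_chart_eq hmn x f hf]

/-! ### The transport lemma -/

/-- **Pointwise transport bound on the torus.** For a lattice configuration `ω ⊆ E(T_n)` and a
base point `x` with chart `f`: `1{C(x) slice-filling}/|C(x)| ≤ 1{0 ↔ ∂ⁱⁿB(m) locally}/|C_loc(0)|`,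
the right-hand side computed in the configuration pulled back along `f`. [folklore] -/
theorem sf_weight_le_local (hmn : 2 * m + 2 ≤ n) [NeZero n] (x : TorusSite 3 n)
    (f : ↥(box 3 m) → TorusSite 3 n) (hf : ∀ w, f w = Torus.proj n w.1 + x)
    {ω : BondConfig (TorusSite 3 n)} (hω : ω ⊆ (torusGraph 3 n).edgeSet) :
    (if ∃ i : Fin 3, ∀ t : ZMod n, ∃ y ∈ openCluster ω x, y i = t
      then ((openCluster ω x).ncard : ℝ)⁻¹ else 0) ≤
    (if ∃ w : ↥(box 3 m), w.1 ∈ innerBoundary (zdGraph 3) (box 3 m) ∧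
          (openGraph (restrictConfig f ω)).Reachable ⟨0, zero_mem_box 3 m⟩ w
      then ((Set.ncard {w : ↥(box 3 m) |
          (openGraph (restrictConfig f ω)).Reachable ⟨0, zero_mem_box 3 m⟩ w} : ℝ))⁻¹
      else 0) := by
  haveI : Nonempty ↥(box 3 m) := ⟨⟨0, zero_mem_box 3 m⟩⟩
  split_ifs with hsf hexit hexit
  · -- both events hold: the local cluster injects into `C(x)`
    have hfin : (openCluster ω x).Finite := Set.toFinite _
    have hle := ncard_reachable_restrictConfig_le (chart_injective hmn x f hf) ω
      ⟨0, zero_mem_box 3 m⟩ (by rw [chart_zero x f hf]; exact hfin)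
    rw [chart_zero x f hf] at hle
    have hpos : (0 : ℝ) < Set.ncard {w : ↥(box 3 m) |
        (openGraph (restrictConfig f ω)).Reachable ⟨0, zero_mem_box 3 m⟩ w} := by
      have hmem : (⟨0, zero_mem_box 3 m⟩ : ↥(box 3 m)) ∈ {w : ↥(box 3 m) |
          (openGraph (restrictConfig f ω)).Reachable ⟨0, zero_mem_box 3 m⟩ w} :=
        SimpleGraph.Reachable.refl _
      exact_mod_cast Nat.pos_of_ne_zero (Set.ncard_ne_zero_of_mem hmem)
    exact inv_anti₀ hpos (by exact_mod_cast hle)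
  · -- slice-filling but no local exit: impossible
    exfalso
    obtain ⟨i, hi⟩ := hsf
    obtain ⟨t, ht⟩ := exists_slice_disjoint_chart hmn x f hf i
    obtain ⟨y, hy, hyt⟩ := hi t
    have hyr : y ∉ Set.range f := by
      rintro ⟨w, rfl⟩
      exact ht w hyt
    have hreach : (openGraph ω).Reachable (f ⟨0, zero_mem_box 3 m⟩) y := by
      rw [chart_zero x f hf]
      exact hy
    obtain ⟨b, ⟨y', hy', hadj⟩, hb⟩ :=
      exists_exit_restrictConfig (chart_injective hmn x f hf) hω hyr hreach
    exact hexit ⟨b, mem_innerBoundary_of_adj_chart x f hf b hy' hadj, hb⟩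
  · positivity
  · exact le_rfl

/-- **The local weight of the box-restricted `ℤ³` configuration is the `ℤ³` integrand**
`1{0 ↔ ∂ⁱⁿB(m) in B(m)} / |{y | 0 ↔ y in B(m)}|`. [folklore] -/
theorem local_weight_restrict_box_eq (m : ℕ) (ω : BondConfig (Site 3)) :
    (if ∃ w : ↥(box 3 m), w.1 ∈ innerBoundary (zdGraph 3) (box 3 m) ∧
          (openGraph (restrictConfig (Subtype.val : ↥(box 3 m) → Site 3) ω)).Reachable
            ⟨0, zero_mem_box 3 m⟩ w
      then ((Set.ncard {w : ↥(box 3 m) |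
          (openGraph (restrictConfig (Subtype.val : ↥(box 3 m) → Site 3) ω)).Reachable
            ⟨0, zero_mem_box 3 m⟩ w} : ℝ))⁻¹
      else 0) =
    (siteToBoundary 3 m).indicator
      (fun ω => ((Set.ncard {y : Site 3 | ω ∈ openConnIn (↑(box 3 m)) 0 y} : ℝ))⁻¹) ω := by
  have hconn : ∀ y : Site 3, ω ∈ openConnIn (↑(box 3 m)) 0 y ↔ ∃ hy : y ∈ box 3 m,
      (openGraph (restrictConfig (Subtype.val : ↥(box 3 m) → Site 3) ω)).Reachable
        ⟨0, zero_mem_box 3 m⟩ ⟨y, hy⟩ := by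
    intro y
    rw [mem_openConnIn_iff_restrictConfig]
    constructor
    · rintro ⟨_, hy, h⟩
      exact ⟨hy, h⟩
    · rintro ⟨hy, h⟩
      exact ⟨zero_mem_box 3 m, hy, h⟩
  have hevent : ω ∈ siteToBoundary 3 m ↔ ∃ w : ↥(box 3 m),
      w.1 ∈ innerBoundary (zdGraph 3) (box 3 m) ∧
      (openGraph (restrictConfig (Subtype.val : ↥(box 3 m) → Site 3) ω)).Reachable
        ⟨0, zero_mem_box 3 m⟩ w := by
    simp only [siteToBoundary, mem_setOf_eq, hconn]
    constructor
    · rintro ⟨y, hyb, hy, h⟩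
      exact ⟨⟨y, hy⟩, hyb, h⟩
    · rintro ⟨⟨y, hy⟩, hyb, h⟩
      exact ⟨y, hyb, hy, h⟩
  have hset : {y : Site 3 | ω ∈ openConnIn (↑(box 3 m)) 0 y} =
      Subtype.val '' {w : ↥(box 3 m) |
        (openGraph (restrictConfig (Subtype.val : ↥(box 3 m) → Site 3) ω)).Reachable
          ⟨0, zero_mem_box 3 m⟩ w} := by
    ext y
    simp only [mem_setOf_eq, hconn, Set.mem_image]
    constructor
    · rintro ⟨hy, h⟩
      exact ⟨⟨y, hy⟩, h, rfl⟩
    · rintro ⟨⟨y', hy'⟩, h, rfl⟩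
      exact ⟨hy', h⟩
  by_cases h : ω ∈ siteToBoundary 3 m
  · rw [Set.indicator_of_mem h, if_pos (hevent.1 h), hset,
      Set.ncard_image_of_injective _ Subtype.val_injective]
  · rw [Set.indicator_of_notMem h, if_neg (fun h' => h (hevent.2 h'))]

/-- **Per-vertex transport.** For `2m + 2 ≤ n`, every base point `x` of `T_n` and every `p`:
`E_{T_n,p}[1{C(x) sf}/|C(x)|] ≤ E_{ℤ³,p}[1{0 ↔ ∂ⁱⁿB(m) in B(m)}/|C^{B(m)}(0)|]`. [folklore] -/
theorem integral_sf_weight_le (hmn : 2 * m + 2 ≤ n) [NeZero n] (p : unitInterval)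
    (x : TorusSite 3 n) :
    ∫ ω, (if ∃ i : Fin 3, ∀ t : ZMod n, ∃ y ∈ openCluster ω x, y i = t
      then ((openCluster ω x).ncard : ℝ)⁻¹ else 0) ∂(bondPercolation (torusGraph 3 n) p) ≤
    ∫ ω, (siteToBoundary 3 m).indicator
      (fun ω => ((Set.ncard {y : Site 3 | ω ∈ openConnIn (↑(box 3 m)) 0 y} : ℝ))⁻¹) ω
      ∂(bondPercolation (zdGraph 3) p) := by
  set f : ↥(box 3 m) → TorusSite 3 n := fun w => Torus.proj n w.1 + x with hfdef
  have hf : ∀ w, f w = Torus.proj n w.1 + x := fun w => rfl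
  set g : BondConfig ↥(box 3 m) → ℝ := fun η =>
    if ∃ w : ↥(box 3 m), w.1 ∈ innerBoundary (zdGraph 3) (box 3 m) ∧
        (openGraph η).Reachable ⟨0, zero_mem_box 3 m⟩ w
      then ((Set.ncard {w : ↥(box 3 m) | (openGraph η).Reachable ⟨0, zero_mem_box 3 m⟩ w} : ℝ))⁻¹
      else 0 with hg
  have hae : ∀ᵐ ω ∂(bondPercolation (torusGraph 3 n) p), ω ⊆ (torusGraph 3 n).edgeSet :=
    ProbabilityTheory.setBernoulli_ae_subset
  calc ∫ ω, (if ∃ i : Fin 3, ∀ t : ZMod n, ∃ y ∈ openCluster ω x, y i = t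
          then ((openCluster ω x).ncard : ℝ)⁻¹ else 0) ∂(bondPercolation (torusGraph 3 n) p)
      ≤ ∫ ω, g (restrictConfig f ω) ∂(bondPercolation (torusGraph 3 n) p) := by
        refine integral_mono_ae Integrable.of_finite Integrable.of_finite ?_
        filter_upwards [hae] with ω hω
        exact sf_weight_le_local hmn x f hf hω
    _ = ∫ ω, g (restrictConfig (Subtype.val : ↥(box 3 m) → Site 3) ω)
          ∂(bondPercolation (zdGraph 3) p) := integral_restrictConfig_chart_eq hmn x f hf p g
    _ = ∫ ω, (siteToBoundary 3 m).indicator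
          (fun ω => ((Set.ncard {y : Site 3 | ω ∈ openConnIn (↑(box 3 m)) 0 y} : ℝ))⁻¹) ω
          ∂(bondPercolation (zdGraph 3) p) :=
        integral_congr_ae (Eventually.of_forall fun ω => local_weight_restrict_box_eq m ω)

/-- **Lemma E of the card (box form), `SliceFillingTransport` (item stmt-CriticalPhenomena-5417)
as a theorem**: for all `p` and `n ≥ 4`, with `m = ⌊(n-2)/2⌋`,
`E_{T_n,p}[N_sf] ≤ n³ · E_{ℤ³,p}[1{0 ↔ ∂ⁱⁿB(m) in B(m)} / |C^{B(m)}(0)|]`. [folklore] -/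
theorem sliceFillingTransport_holds : SliceFillingTransport := by
  intro p n hn
  haveI : NeZero n := ⟨by omega⟩
  have hmn : 2 * ((n - 2) / 2) + 2 ≤ n := by omega
  set m := (n - 2) / 2 with hm
  -- `N_sf` as a mass-transport sum
  have hN : ∀ ω : BondConfig (TorusSite 3 n),
      (Set.ncard {S : Set (TorusSite 3 n) | (∃ x, S = openCluster ω x) ∧
        ∃ i : Fin 3, ∀ t : ZMod n, ∃ y ∈ S, y i = t} : ℝ) =
      ∑ x, (if ∃ i : Fin 3, ∀ t : ZMod n, ∃ y ∈ openCluster ω x, y i = t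
        then ((openCluster ω x).ncard : ℝ)⁻¹ else 0) := fun ω =>
    ncard_clusters_eq_sum ω (fun S => ∃ i : Fin 3, ∀ t : ZMod n, ∃ y ∈ S, y i = t)
  calc ∫ ω, (Set.ncard {S : Set (TorusSite 3 n) | (∃ x, S = openCluster ω x) ∧
          ∃ i : Fin 3, ∀ t : ZMod n, ∃ y ∈ S, y i = t} : ℝ) ∂(bondPercolation (torusGraph 3 n) p)
      = ∫ ω, ∑ x, (if ∃ i : Fin 3, ∀ t : ZMod n, ∃ y ∈ openCluster ω x, y i = t
          then ((openCluster ω x).ncard : ℝ)⁻¹ else 0) ∂(bondPercolation (torusGraph 3 n) p) :=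
        integral_congr_ae (Eventually.of_forall hN)
    _ = ∑ x, ∫ ω, (if ∃ i : Fin 3, ∀ t : ZMod n, ∃ y ∈ openCluster ω x, y i = t
          then ((openCluster ω x).ncard : ℝ)⁻¹ else 0) ∂(bondPercolation (torusGraph 3 n) p) :=
        integral_finsetSum _ fun x _ => Integrable.of_finite
    _ ≤ ∑ _x : TorusSite 3 n, ∫ ω, (siteToBoundary 3 m).indicator
          (fun ω => ((Set.ncard {y : Site 3 | ω ∈ openConnIn (↑(box 3 m)) 0 y} : ℝ))⁻¹) ω
          ∂(bondPercolation (zdGraph 3) p) :=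
        Finset.sum_le_sum fun x _ => integral_sf_weight_le hmn p x
    _ = (n : ℝ) ^ 3 * ∫ ω, (siteToBoundary 3 m).indicator
          (fun ω => ((Set.ncard {y : Site 3 | ω ∈ openConnIn (↑(box 3 m)) 0 y} : ℝ))⁻¹) ω
          ∂(bondPercolation (zdGraph 3) p) := by
        rw [Finset.sum_const, nsmul_eq_mul]
        congr 1
        simp [Finset.card_univ, ZMod.card]

end PercTorusSliceFillingThinClusterTransport

/-- **Item `stmt-CriticalPhenomena-5418` (`PercTorusSliceFilling.ThinClusterTransport`), proved
unconditionally**: `ThinClusterRarity → TorusNonProliferation`. By the transport lemma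
`E_{T_n,p_c}[N_sf] ≤ n³ · E_{ℤ³,p_c}[1{A_m}/|C^{B(m)}(0)|] ≤ n³ C/m³ ≤ 125 C` (`m = ⌊(n-2)/2⌋`,
`n ≤ 5m` for `n ≥ 4`), `N_sf ≤ 27` for `n = 3`, and Markov's inequality. [folklore] -/
theorem thinClusterTransport_proof :
    Summit.CriticalPhenomena.PercolationContinuityZ3.Theses.PercTorusSliceFilling.ThinClusterTransport :=
  PercTorusSliceFillingThinClusterTransport.thinClusterTransport_of_sliceFillingTransport
    PercTorusSliceFillingThinClusterTransport.sliceFillingTransport_holds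

end Summit.CriticalPhenomena.PercolationContinuityZ3.Theorems
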